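import Summits.QuantumFields.YangMills.Theorems.BalabanLadderUVRecord13SepDefs
import Summits.QuantumFields.YangMills.Theorems.BalabanLadderUVRecord13Defs
import Literature.MathematicalPhysics.QuantumFieldTheory.Balaban1983to89.Node00.N23Dossier
import HarnessLib

/-!
# BalabanLadder ∕ UV — kernels for the v1.2 (separated-range) Stage-13 UV packages: Track A's rev-18 composition at every `N`, θ ⇒ (D, w),
# the Stage-0 projections (today's body of `BalabanLadder.UV` at `N = 2`), the v1.1 ⇒ v1.2 bridges, and the T⁴ apex AT the pinned record

OS-ASSEMBLY BOOKKEEPING (cell `ym-fleet`, seat `ym-osasm-p1`, director-ym R136 (iii); `--supports stmt-QuantumFields-19351`).  Pure theorems over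
`Theorems/BalabanLadderUVRecord13SepDefs.lean` (`UVAtParams13Sep`, `UVAtRecord13CSep`); 0 `sorry`, 0 `def`, standard axioms; COUNT-NEUTRAL — every
hypothesis is an OPEN item's text used by modus ponens.  The `Provisos₁₃Sep` twin of `Theorems/BalabanLadderUVRecord13.lean` (p489689): the same ten
kernels with tokens `Provisos₁₃ ↦ Provisos₁₃Sep`, `datumOfRecord₁₃ ↦ datumOfRecord₁₃Sep`, `IsRecordOfRecord₁₃C ↦ IsRecordOfRecord₁₃CSep` (all from
`Node00/Record13.lean` v1.2 §9b), PLUS §4 the two v1.1 ⇒ v1.2 bridges `uvAtParams13Sep_of_uvAtParams13` (`Provisos₁₃.toSep`, same datum by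
`datumOfRecord₁₃Sep_toSep`, `rfl`) and `uvAtRecord13CSep_of_uvAtRecord13C` (`IsRecordOfRecord₁₃C.toSep`) — every v1.1-keyed producer still feeds the
v1.2 station.

* §1 `uvAtParams13Sep_of_chain` — the detail route's rev-18 deciding composition (the four item texts re-keyed to `Provisos₁₃Sep` per director-ym
  ★★ LINE №138 ∕ plan g67 ACK-138, `2 ↦ N`, copied INLINE so that this module imports no Theses file) ⇒ `UVAtParams13Sep N`, i.e. the re-keyed
  `BalabanUVNodes.closes` STOPPED one line before its Stage-0 projection; `uvAtRecord13CSep_of_recordChain` — the same in (D, w) currency.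
* §2 `uvAtRecord13CSep_of_uvAtParams13Sep` (θ ⇒ (D, w), `Node00.exists_world_isRecordOfRecord₁₃CSep`, full window `w.γ = θ.γ`),
  `params_of_uvAtRecord13CSep`, and the Stage-0 projections `stage0_of_uvAtParams13Sep` ∕ `stage0_of_uvAtRecord13CSep` whose conclusion is VERBATIM
  today's body of `YMDAG.UVSplit.UVD59 N` ∕ (at `N = 2`) `Summit.QuantumFields.YangMills.Theses.BalabanLadder.UV` (`Node00.isDatumOfRecord₀_datumOfRecord₁₃Sep`,
  `rfl`) — a consumer closes those goals by `exact`.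
* §3 the T⁴ apex AT THE PINNED v1.2 RECORD in its three currencies (`Node00.continuumYM4Torus_datumOfRecord₁₃Sep`,
  `Node00.isPrintedAveraged_of_isRecordOfRecord₁₃CSep`, `Node00.continuumYM4TorusLaw_of_isDatumOfRecord₀`).
* §4 the v1.1 ⇒ v1.2 bridges.

ROUTE-INDEPENDENT BY DESIGN: no `Theses` import, no module in a route's cone.  HONEST FRAMING: knits of a CONDITIONAL chain; the packages are
HYPOTHESES (Track A's four items are open); one finite four-torus programme per family at fixed ε; NOT infinite volume, NOT OS on ℝ⁴, NOT a mass gap,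
NOT Clay.
-/

set_option autoImplicit false

namespace Summit.QuantumFields.YangMills.Cruxes.UV.Record13Sep

open Literature.MathematicalPhysics.QuantumFieldTheory.Balaban1983to89
open Literature.MathematicalPhysics.QuantumFieldTheory.Balaban1983to89.T4Continuum
open Literature.MathematicalPhysics.QuantumFieldTheory.Balaban1983to89.T4ContinuumYM4Torus

/-! ## §1 Track A's deciding composition, stopped before the Stage-0 projection -/

section Chain

variable {N : ℕ} [NeZero N]

/-- **THE θ-KEYED STAGE-13 UV PACKAGE FROM THE FOUR ITEM TEXTS** (announced rev 18 of `route-QuantumFields-BalabanUVNodes`, `2 ↦ N`): inhabitation of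
the admissible unity tuples with non-degenerate slots (K0⁗ `Record13SepInhabited`) · (B) + window at some such tuple (K1⁗ `StabilityBAtRecordR13Sep`) · END given
(B) + window (K2⁗ `EndpointGivenBR13Sep`) · hybrid-NE7 spine given (B) + END (K3⁗ `SpineGivenEndpointR13Sep`) ⟹ `UVAtParams13Sep N`.  Literally the term of the rev-18
`BalabanUVNodes.closes` (plan kit `D65-REV16/out/glue16.lean`) minus its last line; at `N = 2` the route items ARE these binders (by unfolding). -/
theorem uvAtParams13Sep_of_chain
    (h0 : ∀ F : T4Family, ∃ θ : Node00.Stage13Params F N, θ.Provisos₁₃Sep F N ∧ (θ.ZtUnity F N ∧ θ.SlotsNondegenerate₁₃ F N) ∧ θ.Admissible F N)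
    (h1 : ∀ F : T4Family, (∃ θ : Node00.Stage13Params F N, θ.Provisos₁₃Sep F N ∧ (θ.ZtUnity F N ∧ θ.SlotsNondegenerate₁₃ F N) ∧ θ.Admissible F N) →
      ∃ (θ : Node00.Stage13Params F N) (h : θ.Provisos₁₃Sep F N), (θ.ZtUnity F N ∧ θ.SlotsNondegenerate₁₃ F N) ∧ θ.Admissible F N ∧
        B16.EndStatementBPrinted (Node00.datumOfRecord₁₃Sep F N θ h).C ∧ ∃ γ₁ : ℝ, 0 < γ₁ ∧ ∀ γ : ℝ, 0 < γ → γ ≤ γ₁ →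
          ∃ P : B12.RunParams, 1 ≤ P.K ∧ ((Node00.datumOfRecord₁₃Sep F N θ h).C P).flow.InInterval γ P.K)
    (h2 : ∀ (F : T4Family) (θ : Node00.Stage13Params F N) (h : θ.Provisos₁₃Sep F N), (θ.ZtUnity F N ∧ θ.SlotsNondegenerate₁₃ F N) → θ.Admissible F N →
      B16.EndStatementBPrinted (Node00.datumOfRecord₁₃Sep F N θ h).C → (∃ γ₁ : ℝ, 0 < γ₁ ∧ ∀ γ : ℝ, 0 < γ → γ ≤ γ₁ →
        ∃ P : B12.RunParams, 1 ≤ P.K ∧ ((Node00.datumOfRecord₁₃Sep F N θ h).C P).flow.InInterval γ P.K) →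
      DagBinding.EndpointExistence (Node00.datumOfRecord₁₃Sep F N θ h).C.toB12)
    (h3 : ∀ (F : T4Family) (θ : Node00.Stage13Params F N) (h : θ.Provisos₁₃Sep F N), (θ.ZtUnity F N ∧ θ.SlotsNondegenerate₁₃ F N) → θ.Admissible F N →
      B16.EndStatementBPrinted (Node00.datumOfRecord₁₃Sep F N θ h).C → DagBinding.EndpointExistence (Node00.datumOfRecord₁₃Sep F N θ h).C.toB12 →
      T4ApexHybrid.HybridNE7Under (Node00.datumOfRecord₁₃Sep F N θ h) (DagBinding.EndpointExistence (Node00.datumOfRecord₁₃Sep F N θ h).C.toB12)) :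
    UVAtParams13Sep N := by
  intro F
  obtain ⟨θ, h, hU, hθ, hb, hwin⟩ := h1 F (h0 F)
  have hend : DagBinding.EndpointExistence (Node00.datumOfRecord₁₃Sep F N θ h).C.toB12 := h2 F θ h hU hθ hb hwin
  exact ⟨θ, h, hU, hθ, hb, hwin, hend, h3 F θ h hU hθ hb hend⟩

/-- **THE (D, w)-KEYED STAGE-13 UV PACKAGE FROM THE FOUR-CHAIN IN RECORD CURRENCY**: inhabitation of the Stage-13 record class · (B) + window at some
record · END given (B) + window · spine given (B) + END ⟹ `UVAtRecord13CSep N`. -/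
theorem uvAtRecord13CSep_of_recordChain
    (h0 : ∀ F : T4Family, ∃ (D : FiniteEpsData F (Matrix.specialUnitaryGroup (Fin N) ℂ)) (w : DagBinding.WorldP),
      Node00.IsRecordOfRecord₁₃CSep F N D w)
    (h1 : ∀ F : T4Family, (∃ (D : FiniteEpsData F (Matrix.specialUnitaryGroup (Fin N) ℂ)) (w : DagBinding.WorldP),
        Node00.IsRecordOfRecord₁₃CSep F N D w) →
      ∃ (D : FiniteEpsData F (Matrix.specialUnitaryGroup (Fin N) ℂ)) (w : DagBinding.WorldP), Node00.IsRecordOfRecord₁₃CSep F N D w ∧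
        B16.EndStatementBPrinted D.C ∧ ∃ γ₁ : ℝ, 0 < γ₁ ∧ ∀ γ : ℝ, 0 < γ → γ ≤ γ₁ →
          ∃ P : B12.RunParams, 1 ≤ P.K ∧ (D.C P).flow.InInterval γ P.K)
    (h2 : ∀ (F : T4Family) (D : FiniteEpsData F (Matrix.specialUnitaryGroup (Fin N) ℂ)) (w : DagBinding.WorldP),
      Node00.IsRecordOfRecord₁₃CSep F N D w → B16.EndStatementBPrinted D.C → (∃ γ₁ : ℝ, 0 < γ₁ ∧ ∀ γ : ℝ, 0 < γ → γ ≤ γ₁ →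
        ∃ P : B12.RunParams, 1 ≤ P.K ∧ (D.C P).flow.InInterval γ P.K) → DagBinding.EndpointExistence D.C.toB12)
    (h3 : ∀ (F : T4Family) (D : FiniteEpsData F (Matrix.specialUnitaryGroup (Fin N) ℂ)) (w : DagBinding.WorldP),
      Node00.IsRecordOfRecord₁₃CSep F N D w → B16.EndStatementBPrinted D.C → DagBinding.EndpointExistence D.C.toB12 →
        T4ApexHybrid.HybridNE7Under D (DagBinding.EndpointExistence D.C.toB12)) :
    UVAtRecord13CSep N := by
  intro F
  obtain ⟨D, w, hR, hb, hwin⟩ := h1 F (h0 F)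
  have hend : DagBinding.EndpointExistence D.C.toB12 := h2 F D w hR hb hwin
  exact ⟨D, w, hR, hb, hwin, hend, h3 F D w hR hb hend⟩

end Chain

/-! ## §2 The change of currency θ ⇒ (D, w) and the Stage-0 projections (the bodies of `UVD59 N` ∕ `BalabanLadder.UV`) -/

section Projections

variable {N : ℕ} [NeZero N]

/-- **θ ⇒ (D, w)**: the θ-keyed package gives the (D, w)-keyed one — every admissible Stage-13 tuple with provisos IS a Stage-13 record at a world bound to
its construction, with the full window `w.γ = θ.γ` (`Node00.exists_world_isRecordOfRecord₁₃C`; `0 < θ.γ` from admissibility); the unity clause is dropped. -/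
theorem uvAtRecord13CSep_of_uvAtParams13Sep (h : UVAtParams13Sep N) : UVAtRecord13CSep N := by
  intro F
  obtain ⟨θ, hP, -, hθ, hb, hwin, hend, hNE⟩ := h F
  obtain ⟨w, hw, -⟩ := Node00.exists_world_isRecordOfRecord₁₃CSep F N θ hP hθ ⟨hθ.toStage9.gamma_pos, le_rfl⟩
  exact ⟨Node00.datumOfRecord₁₃Sep F N θ hP, w, hw, hb, hwin, hend, hNE⟩

/-- **(D, w) ⇒ θ, without unity**: a (D, w)-keyed package reads through Bałaban's parameters — the record predicate certifies admissible θ with provisos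
and `D = datumOfRecord₁₃ F N θ h` (`Node00.exists_provisos_of_isRecordOfRecord₁₃C`); the partition-of-unity ∕ non-degeneracy clause of `UVAtParams13Sep` is
NOT recoverable from the record predicate (it is K0⁗'s extra datum), so this is not a converse of `uvAtRecord13CSep_of_uvAtParams13Sep`. -/
theorem params_of_uvAtRecord13CSep (h : UVAtRecord13CSep N) (F : T4Family) :
    ∃ (θ : Node00.Stage13Params F N) (hP : θ.Provisos₁₃Sep F N), θ.Admissible F N ∧
      B16.EndStatementBPrinted (Node00.datumOfRecord₁₃Sep F N θ hP).C ∧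
      (∃ γ₁ : ℝ, 0 < γ₁ ∧ ∀ γ : ℝ, 0 < γ → γ ≤ γ₁ →
        ∃ P : B12.RunParams, 1 ≤ P.K ∧ ((Node00.datumOfRecord₁₃Sep F N θ hP).C P).flow.InInterval γ P.K) ∧
      DagBinding.EndpointExistence (Node00.datumOfRecord₁₃Sep F N θ hP).C.toB12 ∧
      T4ApexHybrid.HybridNE7Under (Node00.datumOfRecord₁₃Sep F N θ hP)
        (DagBinding.EndpointExistence (Node00.datumOfRecord₁₃Sep F N θ hP).C.toB12) := by
  obtain ⟨D, w, hR, hb, hwin, hend, hNE⟩ := h F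
  obtain ⟨θ, hP, hθ, rfl⟩ := Node00.exists_provisos_of_isRecordOfRecord₁₃CSep hR
  exact ⟨θ, hP, hθ, hb, hwin, hend, hNE⟩

/-- **THE STAGE-0 PROJECTION OF THE (D, w)-KEYED PACKAGE** — conclusion VERBATIM the body of `YMDAG.UVSplit.UVD59 N` (at `N = 2`: of
`Summit.QuantumFields.YangMills.Theses.BalabanLadder.UV`): on every family a Stage-0 datum of record with (B), END and the spine
(`Node00.isDatumOfRecord₀_of_isRecordOfRecord₁₃C`; the window and the world are forgotten).  A consumer closes `UVD59 N` ∕ `BalabanLadder.UV` by `exact`. -/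
theorem stage0_of_uvAtRecord13CSep (h : UVAtRecord13CSep N) (F : T4Family) :
    ∃ D : FiniteEpsData F (Matrix.specialUnitaryGroup (Fin N) ℂ), Node00.IsDatumOfRecord₀ F N D ∧ B16.EndStatementBPrinted D.C ∧
      DagBinding.EndpointExistence D.C.toB12 ∧ T4ApexHybrid.HybridNE7Under D (DagBinding.EndpointExistence D.C.toB12) := by
  obtain ⟨D, w, hR, hb, -, hend, hNE⟩ := h F
  exact ⟨D, Node00.isDatumOfRecord₀_of_isRecordOfRecord₁₃CSep hR, hb, hend, hNE⟩

/-- **THE STAGE-0 PROJECTION OF THE θ-KEYED PACKAGE** — the last line of the rev-18 `BalabanUVNodes.closes` with `2 ↦ N`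
(`Node00.isDatumOfRecord₀_datumOfRecord₁₃`, `rfl`); conclusion VERBATIM the body of `YMDAG.UVSplit.UVD59 N` ∕ (at `N = 2`) today's body of `BalabanLadder.UV`.
Under a θ-pinned E1 text of `UV` this is, at `N = 2`, the one-direction tether `UV → UVD59 2`. -/
theorem stage0_of_uvAtParams13Sep (h : UVAtParams13Sep N) (F : T4Family) :
    ∃ D : FiniteEpsData F (Matrix.specialUnitaryGroup (Fin N) ℂ), Node00.IsDatumOfRecord₀ F N D ∧ B16.EndStatementBPrinted D.C ∧
      DagBinding.EndpointExistence D.C.toB12 ∧ T4ApexHybrid.HybridNE7Under D (DagBinding.EndpointExistence D.C.toB12) := by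
  obtain ⟨θ, hP, -, -, hb, -, hend, hNE⟩ := h F
  exact ⟨Node00.datumOfRecord₁₃Sep F N θ hP, Node00.isDatumOfRecord₀_datumOfRecord₁₃Sep F N θ hP, hb, hend, hNE⟩

end Projections

/-! ## §3 The T⁴ apex AT THE PINNED RECORD, in its three currencies -/

section Apex

variable {N : ℕ} [NeZero N]

/-- **THE APEX AT THE θ-KEYED RECORD, ∀- and ∃-readings**: on every family an admissible unity tuple θ with provisos whose datum of record has endpoint
existence AND `ContinuumYM4Torus ∧ ContinuumYM4TorusE` — for all small `γ`, `g` and every (resp. some) tuned bare-coupling sequence the joint expectations of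
the unit-scale averaged loop variables converge as `ε → 0`, limit points agree, are reflection positive and torus covariant
(`Node00.continuumYM4Torus_datumOfRecord₁₃` + `continuumYM4TorusE_of_endpoint`). -/
theorem apex_of_uvAtParams13Sep (h : UVAtParams13Sep N) (F : T4Family) :
    ∃ (θ : Node00.Stage13Params F N) (hP : θ.Provisos₁₃Sep F N), (θ.ZtUnity F N ∧ θ.SlotsNondegenerate₁₃ F N) ∧ θ.Admissible F N ∧
      DagBinding.EndpointExistence (Node00.datumOfRecord₁₃Sep F N θ hP).C.toB12 ∧
      ContinuumYM4Torus (Node00.datumOfRecord₁₃Sep F N θ hP) ∧ ContinuumYM4TorusE (Node00.datumOfRecord₁₃Sep F N θ hP) := by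
  obtain ⟨θ, hP, hU, hθ, hb, -, hend, hNE⟩ := h F
  have hT : ContinuumYM4Torus (Node00.datumOfRecord₁₃Sep F N θ hP) := Node00.continuumYM4Torus_datumOfRecord₁₃Sep F N θ hP hb hend hNE
  exact ⟨θ, hP, hU, hθ, hend, hT, continuumYM4TorusE_of_endpoint hend hT⟩

/-- **THE APEX AT THE θ-KEYED RECORD, LAW-READING**: on every family an admissible unity tuple θ with provisos AT WHOSE datum of record
`ContinuumYM4TorusLaw` holds — for all small `γ`, `g` and every tuned bare-coupling sequence exactly ONE Borel probability law on the loop cube is the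
full-sequence weak limit of the laws of the unit-scale averaged loop variables, OS-positive on every strict cone and invariant under the unit-torus
isometries (`Node00.continuumYM4TorusLaw_of_isDatumOfRecord₀`; measurability witness `Node00.avgMeasurable_of_isDatumOfRecord₀`). -/
theorem law_of_uvAtParams13Sep (h : UVAtParams13Sep N) (F : T4Family) :
    ∃ (θ : Node00.Stage13Params F N) (hP : θ.Provisos₁₃Sep F N), (θ.ZtUnity F N ∧ θ.SlotsNondegenerate₁₃ F N) ∧ θ.Admissible F N ∧
      DagBinding.EndpointExistence (Node00.datumOfRecord₁₃Sep F N θ hP).C.toB12 ∧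
      ContinuumYM4TorusLaw (Node00.datumOfRecord₁₃Sep F N θ hP)
        (Node00.avgMeasurable_of_isDatumOfRecord₀ (Node00.isDatumOfRecord₀_datumOfRecord₁₃Sep F N θ hP)) := by
  obtain ⟨θ, hP, hU, hθ, hb, -, hend, hNE⟩ := h F
  exact ⟨θ, hP, hU, hθ, hend,
    Node00.continuumYM4TorusLaw_of_isDatumOfRecord₀ (Node00.isDatumOfRecord₀_datumOfRecord₁₃Sep F N θ hP) hb hend hNE⟩

/-- **THE APEX AT A (D, w)-KEYED RECORD, ∀- and ∃-readings** (`continuumYM4_torus_of_endpointExistence_nonvacuous`, B1 by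
`Node00.isPrintedAveraged_of_isRecordOfRecord₁₃C`). -/
theorem apex_of_uvAtRecord13CSep (h : UVAtRecord13CSep N) (F : T4Family) :
    ∃ (D : FiniteEpsData F (Matrix.specialUnitaryGroup (Fin N) ℂ)) (w : DagBinding.WorldP), Node00.IsRecordOfRecord₁₃CSep F N D w ∧
      DagBinding.EndpointExistence D.C.toB12 ∧ ContinuumYM4Torus D ∧ ContinuumYM4TorusE D := by
  obtain ⟨D, w, hR, hb, -, hend, hNE⟩ := h F
  exact ⟨D, w, hR, hend, continuumYM4_torus_of_endpointExistence_nonvacuous D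
    (Node00.isPrintedAveraged_of_isRecordOfRecord₁₃CSep hR) hb hend hNE⟩

/-- **THE APEX AT A (D, w)-KEYED RECORD, LAW-READING** (`Node00.continuumYM4TorusLaw_of_isDatumOfRecord₀` at
`Node00.isDatumOfRecord₀_of_isRecordOfRecord₁₃C`). -/
theorem law_of_uvAtRecord13CSep (h : UVAtRecord13CSep N) (F : T4Family) :
    ∃ (D : FiniteEpsData F (Matrix.specialUnitaryGroup (Fin N) ℂ)) (w : DagBinding.WorldP) (hR : Node00.IsRecordOfRecord₁₃CSep F N D w),
      DagBinding.EndpointExistence D.C.toB12 ∧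
      ContinuumYM4TorusLaw D (Node00.avgMeasurable_of_isDatumOfRecord₀ (Node00.isDatumOfRecord₀_of_isRecordOfRecord₁₃CSep hR)) := by
  obtain ⟨D, w, hR, hb, -, hend, hNE⟩ := h F
  exact ⟨D, w, hR, hend,
    Node00.continuumYM4TorusLaw_of_isDatumOfRecord₀ (Node00.isDatumOfRecord₀_of_isRecordOfRecord₁₃CSep hR) hb hend hNE⟩

end Apex


/-! ## §4 The v1.1 ⇒ v1.2 bridges: every `Provisos₁₃`-keyed package is a `Provisos₁₃Sep`-keyed package -/

section Bridges

variable {N : ℕ} [NeZero N]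

/-- **v1.1 θ-PACKAGE ⇒ v1.2 θ-PACKAGE**: along `Stage13Params.Provisos₁₃.toSep` the datum of record is unchanged (`Node00.datumOfRecord₁₃Sep_toSep`,
`rfl` by proof irrelevance), so `UVAtParams13 N → UVAtParams13Sep N`; every producer keyed to the v1.1 (‴) texts still feeds the re-keyed station. -/
theorem uvAtParams13Sep_of_uvAtParams13 (h : Record13.UVAtParams13 N) : UVAtParams13Sep N := by
  intro F
  obtain ⟨θ, hP, hU, hθ, hb, hwin, hend, hNE⟩ := h F
  exact ⟨θ, hP.toSep, hU, hθ, hb, hwin, hend, hNE⟩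

/-- **v1.1 (D, w)-PACKAGE ⇒ v1.2 (D, w)-PACKAGE** (`Node00.IsRecordOfRecord₁₃C.toSep`): `UVAtRecord13C N → UVAtRecord13CSep N`. -/
theorem uvAtRecord13CSep_of_uvAtRecord13C (h : Record13.UVAtRecord13C N) : UVAtRecord13CSep N := by
  intro F
  obtain ⟨D, w, hR, hb, hwin, hend, hNE⟩ := h F
  exact ⟨D, w, hR.toSep, hb, hwin, hend, hNE⟩

end Bridges

end Summit.QuantumFields.YangMills.Cruxes.UV.Record13Sep
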